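import Mathlib
import HarnessLib
import Summits.HubbardSuperconductivity.HubbardSuperconductivity.Theorems.WeakCouplingBCSKlCertTPrimePocketChartDomination
import Summits.HubbardSuperconductivity.HubbardSuperconductivity.Theorems.WeakCouplingBCSKlCertTPm03ChiHSOfGeometry
import Summits.HubbardSuperconductivity.HubbardSuperconductivity.Theorems.WeakCouplingBCSKlCertB1gTPm03D0125JointChi0Sup

/-!
# Route `WeakCouplingBCS` — certificate half of `WcbcsKohnLuttingerB1g` (stmt-HubbardSuperconductivity-0158):
# «HS-TRANSPORT» — the `(⅛, −0.3)` records MODULO the torus sublevel estimate (N3)′ at the reflected Γ-pocket and their enclosures ONLY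

Cell `gate-hubbard-kl`, seat margin-1 (g18), zero kit; located item «TPRIME-HS-CHART-SIDE» cure (β) (pen g27 (R470)(D): «until p4 g24 seats, margin-1 may take (β)
after (N1)-3b»).  The Fermi curve of `ε_{−3/10}` at `μ ≈ −0.96` is the M-POCKET = four corner arcs of the zone, so the continuous-chart hypotheses `hγ`/`hσ` of
`kltp_m03_HS_of_chart_TSL` (✓ p727153, p4 g23) / `klg_memLp_kernel_of_geometry` (✓ p725080) are fed on the Γ-POCKET of the REFLECTED band
`(t′, μ′) = (+3/10, −μ)` and the Hilbert–Schmidt row is carried back by the particle–hole shift `T` of p4 g19 (`…KlCertTPrimePHReflection*`):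

* §1 `kltp_lindhardFunction_shift_add` (`χ₀[ε_{t′},μ](Tk + Tk′) = χ₀[ε_{−t′},−μ](k + k′)` on `BZ × BZ`, from `klph_kohnLuttingerKernel_shift` at `U = 1`) and
  **`kltp_memLp_kernel_of_reflected`**: `MemLp (χ₀[ε_{−t′},−μ](z.1+z.2)) 2 (σ′⊗σ′) → MemLp (χ₀[ε_{t′},μ](z.1+z.2)) 2 (σ⊗σ)` (both measures finite;
  `(T×T)_*(σ′⊗σ′) = σ⊗σ` by `klph_measurePreserving_shift_fermiCurveMeasure`, `memLp_map_measure_iff`, the kernels agree `σ′⊗σ′`-a.e.).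
* §2 **`kltp_shellVolume_p03_all`**: (SV) for `ε_{+3/10}` at `μ′ ∈ [9/10, 1]` (= `kltp_shellVolume_m03_all` at `−μ′` through the volume-preserving shift).
* §3 **`kltp_p03_HS_of_TSL`** (HS at the reflected Γ-cell from (N3)′ alone: `hσ` = `kltp_fermiCurveMeasure_le_map_polar` ✓ p727793, (SV) = §2, null level set ✓
  `kltp_volume_levelSet`, engine `klg_memLp_kernel_of_geometry`) and **`kltp_m03_HS_of_reflected_TSL`**: for `μ ∈ [−1, −9/10]`,
  `TSL(ε_{3/10}, −μ, kltpPolar (3/10) (−μ)) → MemLp (χ₀[ε_{−3/10},μ](z.1+z.2)) 2 (σ⊗σ)` — the records' `hHS` binder VERBATIM.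
* §4 **`klCertB1gTPm03D0125_dominates_of_TSL`** ((δ) record, `γ = 33811/2²⁰`) and **`klCertB1gTPm03D0125_dominatesJ_of_TSL`** (JOINT record, `γ_J = 88361/2²⁰`):
  `KLB1gDominatesTP (−3/10) mub mua γ(_J)` MODULO (N3)′ — the torus sublevel estimate `λ²{(θ,θ′) ∈ (−π,π]² : |ε_{3/10}(p + γ(θ) + γ(θ′)) + μ| < s} ≤ C s^β`
  uniformly in `p`, some `C ≥ 0`, `0 < β < 2`, per `μ` of the box, along `γ = kltpPolar (3/10) (−μ)` — and the certified enclosures (E4) / (E-J) ONLY.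

HONEST LABEL: the two `(⅛, −0.3)` records stay RECORD-class and CONDITIONAL; after this file their analytic residual is the single named statement (N3)′ about one explicit
trigonometric polynomial (the crux of «TPRIME-LINDHARD-HS», p4 lineage) plus the certified enclosures (numerics outside Lean); nothing DECIDED moves (W3′ +0.0435);
nothing about other cells, `K₃`, `U₀`, the window or superconductivity; a Kohn–Luttinger `O(U²)` channel statement is not ODLRO; nothing here proves superconductivity
in the Hubbard model.  No definitions.
References: S. Raghu, S. A. Kivelson, D. J. Scalapino, Phys. Rev. B 81 (2010) 224505, §II (5)–(8), §III Fig. 3; E. M. Stein, *Singular Integrals and Differentiability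
Properties of Functions* (1970), App. A.1 (Minkowski's integral inequality).
-/

noncomputable section

-- the tree's namespace `Summit.<Summit>.<Problem>.Theorems` repeats the summit name by design (D-0017)
set_option linter.dupNamespace false

namespace Summit.HubbardSuperconductivity.HubbardSuperconductivity.Theorems

open Real Set Filter MeasureTheory KlCertTPrimeJoint Literature.MathematicalPhysics.QuantumLattice
open scoped Topology ENNReal NNReal

/-! ### §1 The Hilbert–Schmidt row TRANSPORTS under the particle–hole shift -/

/-- On the zone the shifted kernel is the reflected kernel: `χ₀[ε_{t′}, μ](T k + T k′) = χ₀[ε_{−t′}, −μ](k + k′)` for `k, k′ ∈ BZ`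
(`klph_kohnLuttingerKernel_shift` at `U = 1`). [cite: RaghuKivelsonScalapino2010, §II (5), (7)] -/
theorem kltp_lindhardFunction_shift_add (tp μ : ℝ) {k k' : Momentum} (hk : k ∈ brillouinZone) (hk' : k' ∈ brillouinZone) :
    lindhardFunction (squareDispersion 1 tp) μ (klphShift k + klphShift k') =
      lindhardFunction (squareDispersion 1 (-tp)) (-μ) (k + k') := by
  have h := klph_kohnLuttingerKernel_shift tp μ 1 hk hk'
  unfold kohnLuttingerKernel at h
  linarith

/-- **HS TRANSPORT** (located item «TPRIME-HS-CHART-SIDE» (β), pen g27 (R470)(D)): the Hilbert–Schmidt row of `(t′, μ)` follows from that of the REFLECTED band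
`(−t′, −μ)` — `σ[ε_{t′}, μ] ⊗ σ[ε_{t′}, μ] = (T × T)_* (σ[ε_{−t′}, −μ] ⊗ σ[ε_{−t′}, −μ])` (`klph_measurePreserving_shift_fermiCurveMeasure`) and the kernels agree on
`BZ × BZ` (which carries the measure). [cite: RaghuKivelsonScalapino2010, §II (5)-(8)] -/
theorem kltp_memLp_kernel_of_reflected (tp μ : ℝ)
    [IsFiniteMeasure (fermiCurveMeasure (squareDispersion 1 (-tp)) (-μ))] [IsFiniteMeasure (fermiCurveMeasure (squareDispersion 1 tp) μ)]
    (hHS : MemLp (fun z : Momentum × Momentum => lindhardFunction (squareDispersion 1 (-tp)) (-μ) (z.1 + z.2)) 2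
      ((fermiCurveMeasure (squareDispersion 1 (-tp)) (-μ)).prod (fermiCurveMeasure (squareDispersion 1 (-tp)) (-μ)))) :
    MemLp (fun z : Momentum × Momentum => lindhardFunction (squareDispersion 1 tp) μ (z.1 + z.2)) 2
      ((fermiCurveMeasure (squareDispersion 1 tp) μ).prod (fermiCurveMeasure (squareDispersion 1 tp) μ)) := by
  set σ' := fermiCurveMeasure (squareDispersion 1 (-tp)) (-μ) with hσ'
  set σ := fermiCurveMeasure (squareDispersion 1 tp) μ with hσ
  have hT := klph_measurePreserving_shift_fermiCurveMeasure tp μ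
  have hTT : MeasurePreserving (Prod.map klphShift klphShift) (σ'.prod σ') (σ.prod σ) := hT.prod hT
  have hfm : Measurable (fun z : Momentum × Momentum => lindhardFunction (squareDispersion 1 tp) μ (z.1 + z.2)) :=
    (measurable_lindhardFunction (measurable_squareDispersion 1 tp) μ).comp measurable_add
  rw [← hTT.map_eq]
  refine (memLp_map_measure_iff hfm.aestronglyMeasurable (hTT.measurable.aemeasurable)).2 ?_
  -- on `BZ × BZ` (full measure for `σ' ⊗ σ'`) the composite is the reflected kernel
  have hε' : Measurable (squareDispersion 1 (-tp)) := measurable_squareDispersion 1 (-tp)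
  have hF0 : σ' (fermiCurve (squareDispersion 1 (-tp)) (-μ))ᶜ = 0 :=
    measure_eq_zero_iff_ae_notMem.2 ((ae_mem_fermiCurve hε' (-μ)).mono fun k hk hk' => hk' hk)
  have hnull : (σ'.prod σ') (((fermiCurve (squareDispersion 1 (-tp)) (-μ))ᶜ ×ˢ (univ : Set Momentum)) ∪
      ((univ : Set Momentum) ×ˢ (fermiCurve (squareDispersion 1 (-tp)) (-μ))ᶜ)) = 0 := by
    refine measure_union_null ?_ ?_
    · rw [Measure.prod_prod, hF0, zero_mul]
    · rw [Measure.prod_prod, hF0, mul_zero]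
  have hae : (fun z : Momentum × Momentum => lindhardFunction (squareDispersion 1 (-tp)) (-μ) (z.1 + z.2)) =ᵐ[σ'.prod σ']
      (fun z : Momentum × Momentum => lindhardFunction (squareDispersion 1 tp) μ (z.1 + z.2)) ∘ Prod.map klphShift klphShift := by
    filter_upwards [measure_eq_zero_iff_ae_notMem.1 hnull] with z hz
    simp only [mem_union, mem_prod, mem_univ, mem_compl_iff, and_true, true_and, not_or, not_not] at hz
    simp only [Function.comp_apply, Prod.map_fst, Prod.map_snd]
    exact (kltp_lindhardFunction_shift_add tp μ hz.1.1 hz.2.1).symm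
  exact hHS.ae_eq hae

/-! ### §2 (SV) and the level set at the reflected Γ-cell `(t′, μ′) = (+3/10, −μ)`, `μ′ ∈ [9/10, 1]` -/

/-- **(SV) at the reflected cell**: `vol(BZ ∩ {|ε_{+3/10} − μ′| < t}) ≤ 500π²·t` for `μ′ ∈ [9/10, 1]` and every `t > 0` — the shift `T` is volume-preserving,
maps `BZ` to `BZ` and `ε_{+3/10} = −ε_{−3/10} ∘ T` on the zone, so this IS `kltp_shellVolume_m03_all` at `−μ′`. [folklore] -/
theorem kltp_shellVolume_p03_all {μ' : ℝ} (hμ1 : 9 / 10 ≤ μ') (hμ2 : μ' ≤ 1) (t : ℝ) (ht0 : 0 < t) :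
    volume (brillouinZone ∩ {p : Momentum | |squareDispersion 1 (3 / 10) p - μ'| < t}) ≤ ENNReal.ofReal (500 * π ^ 2 * t) := by
  have hset : brillouinZone ∩ {p : Momentum | |squareDispersion 1 (3 / 10) p - μ'| < t} =
      klphShift ⁻¹' (brillouinZone ∩ {k : Momentum | |squareDispersion 1 (-3 / 10) k - (-μ')| < t}) := by
    ext p
    simp only [mem_inter_iff, mem_setOf_eq, mem_preimage, klphShift_mem_brillouinZone_iff]
    constructor
    · rintro ⟨hp, h⟩
      refine ⟨hp, ?_⟩
      have e := klph_squareDispersion_shift (-3 / 10) hp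
      rw [e, show -(-3 / 10 : ℝ) = 3 / 10 by norm_num]
      rw [show -squareDispersion 1 (3 / 10) p - -μ' = -(squareDispersion 1 (3 / 10) p - μ') by ring, abs_neg]
      exact h
    · rintro ⟨hp, h⟩
      refine ⟨hp, ?_⟩
      have e := klph_squareDispersion_shift (-3 / 10) hp
      rw [e, show -(-3 / 10 : ℝ) = 3 / 10 by norm_num,
        show -squareDispersion 1 (3 / 10) p - -μ' = -(squareDispersion 1 (3 / 10) p - μ') by ring, abs_neg] at h
      exact h
  have hmeas : MeasurableSet (brillouinZone ∩ {k : Momentum | |squareDispersion 1 (-3 / 10) k - (-μ')| < t}) :=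
    measurableSet_brillouinZone.inter
      (measurableSet_lt ((measurable_squareDispersion 1 (-3 / 10)).sub_const _).abs measurable_const)
  rw [hset, klph_measurePreserving_shift.measure_preimage hmeas.nullMeasurableSet]
  exact kltp_shellVolume_m03_all (μ := -μ') (by linarith) (by linarith) t ht0

/-! ### §3 The Hilbert–Schmidt row of the `(⅛, −0.3)` cell from the torus sublevel estimate at the reflected Γ-pocket ALONE -/

/-- **HS at the reflected Γ-cell from (N3)′ alone**: for `μ′ ∈ [9/10, 1]`, the torus sublevel estimate along the polar chart `γ = kltpPolar (3/10) μ′` gives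
`χ₀[ε_{+3/10}](· + ·; μ′) ∈ L²(σ ⊗ σ)` — (N1) `hσ` = `kltp_fermiCurveMeasure_le_map_polar` ✓, (N2)′ = `kltp_shellVolume_p03_all` ✓, null level set ✓ `kltp_volume_levelSet`.
[cite: SteinSingularIntegrals1970, App. A.1] -/
theorem kltp_p03_HS_of_TSL {μ' : ℝ} (hμ1 : 9 / 10 ≤ μ') (hμ2 : μ' ≤ 1) {C β : ℝ} (hC : 0 ≤ C) (hβ0 : 0 < β) (hβ2 : β < 2)
    (hTSL : ∀ (p : Momentum) (s : ℝ), 0 < s →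
      ((volume.restrict (Ioc (-π) π)).prod (volume.restrict (Ioc (-π) π)))
        {z : ℝ × ℝ | |squareDispersion 1 (3 / 10) (p + (kltpPolar (3 / 10) μ' z.1 + kltpPolar (3 / 10) μ' z.2)) - μ'| < s} ≤
          ENNReal.ofReal (C * s ^ β)) :
    MemLp (fun z : Momentum × Momentum => lindhardFunction (squareDispersion 1 (3 / 10)) μ' (z.1 + z.2)) 2
      ((fermiCurveMeasure (squareDispersion 1 (3 / 10)) μ').prod (fermiCurveMeasure (squareDispersion 1 (3 / 10)) μ')) := by
  have htp : |(3 / 10 : ℝ)| < 1 / 2 := by rw [abs_of_pos (by norm_num)]; norm_num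
  have hμ₁ : -4 - 4 * (3 / 10 : ℝ) < μ' := by linarith
  have hμ₂ : μ' < 4 * (3 / 10 : ℝ) := by linarith
  obtain ⟨w₁, -, hσ⟩ := kltp_fermiCurveMeasure_le_map_polar htp hμ₁ hμ₂
  exact klg_memLp_kernel_of_geometry (continuous_squareDispersion 1 (3 / 10)) (continuous_kltpPolar htp hμ₁ hμ₂) μ' hσ hC hβ0 hβ2
    (by positivity : (0 : ℝ) ≤ 500 * π ^ 2) hTSL (fun t ht => kltp_shellVolume_p03_all hμ1 hμ2 t ht) (kltp_volume_levelSet (3 / 10) htp μ')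

/-- **THE (δ) CELL'S HILBERT–SCHMIDT ROW FROM (N3)′ ALONE**: for `μ ∈ [−1, −9/10]` (⊃ the record's box), the torus sublevel estimate for `ε_{+3/10}` at `−μ` along
`kltpPolar (3/10) (−μ)` gives `χ₀[ε_{−3/10}](· + ·; μ) ∈ L²(σ ⊗ σ)` — chart, DOS domination, shell volume, null level set and the particle–hole transport are all
theorems now. [cite: SteinSingularIntegrals1970, App. A.1] -/
theorem kltp_m03_HS_of_reflected_TSL {μ : ℝ} (hμ1 : -1 ≤ μ) (hμ2 : μ ≤ -9 / 10) {C β : ℝ} (hC : 0 ≤ C) (hβ0 : 0 < β) (hβ2 : β < 2)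
    (hTSL : ∀ (p : Momentum) (s : ℝ), 0 < s →
      ((volume.restrict (Ioc (-π) π)).prod (volume.restrict (Ioc (-π) π)))
        {z : ℝ × ℝ | |squareDispersion 1 (3 / 10) (p + (kltpPolar (3 / 10) (-μ) z.1 + kltpPolar (3 / 10) (-μ) z.2)) - -μ| < s} ≤
          ENNReal.ofReal (C * s ^ β)) :
    MemLp (fun z : Momentum × Momentum => lindhardFunction (squareDispersion 1 (-3 / 10)) μ (z.1 + z.2)) 2
      ((fermiCurveMeasure (squareDispersion 1 (-3 / 10)) μ).prod (fermiCurveMeasure (squareDispersion 1 (-3 / 10)) μ)) := by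
  have h := kltp_p03_HS_of_TSL (μ' := -μ) (by linarith) (by linarith) hC hβ0 hβ2 hTSL
  have htp : |(3 / 10 : ℝ)| < 1 / 2 := by rw [abs_of_pos (by norm_num)]; norm_num
  -- both Fermi-curve measures are finite (Γ side: the chart; pocket side: the generic speed floor)
  haveI h1 : IsFiniteMeasure (fermiCurveMeasure (squareDispersion 1 (-(-3 / 10))) (-μ)) := by
    rw [show -(-3 / 10 : ℝ) = 3 / 10 by norm_num]
    exact kltp_isFiniteMeasure_polar htp (μ := -μ) (by linarith) (by linarith)
  haveI h2 : IsFiniteMeasure (fermiCurveMeasure (squareDispersion 1 (-3 / 10)) μ) :=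
    kltp_isFiniteMeasure_pocket (tp := -3 / 10) (by norm_num) (by norm_num) (by linarith) (by linarith) (by nlinarith)
  refine kltp_memLp_kernel_of_reflected (-3 / 10) μ ?_
  rw [show -(-3 / 10 : ℝ) = 3 / 10 by norm_num]
  exact h

/-! ### §4 The two `(⅛, −0.3)` records MODULO (N3)′ and their enclosures ONLY -/

/-- The record's box lies in `[−1, −9/10]`. [folklore] -/
theorem klCertB1gTPm03D0125_box_mem' :
    ∀ bx ∈ klCertB1gTPm03D0125.boxes, ∀ μ ∈ Set.Icc (bx.mulo : ℝ) (bx.muhi : ℝ), -1 ≤ μ ∧ μ ≤ -9 / 10 := by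
  intro bx hbx μ hμ
  have hbox : bx.mulo = (-4321685426123455 : ℚ) / 4503599627370496 ∧ bx.muhi = (-8643302132770191 : ℚ) / 9007199254740992 := by
    simp only [klCertB1gTPm03D0125, List.mem_singleton] at hbx
    subst hbx
    exact ⟨rfl, rfl⟩
  obtain ⟨hlo, hhi⟩ := hμ
  rw [hbox.1] at hlo
  rw [hbox.2] at hhi
  push_cast at hlo hhi
  exact ⟨by linarith, by linarith⟩

/-- **The (δ) record `klCertB1gTPm03D0125` by `γ = 33811/2²⁰` MODULO the torus sublevel estimate (N3)′ at the reflected Γ-pocket + the enclosures (E4) ONLY.**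
[cite: RaghuKivelsonScalapino2010, §III Fig. 3] -/
theorem klCertB1gTPm03D0125_dominates_of_TSL {C β : ℝ} (hC : 0 ≤ C) (hβ0 : 0 < β) (hβ2 : β < 2)
    (hTSL : ∀ bx ∈ klCertB1gTPm03D0125.boxes, ∀ μ ∈ Set.Icc (bx.mulo : ℝ) (bx.muhi : ℝ), ∀ (p : Momentum) (s : ℝ), 0 < s →
      ((volume.restrict (Ioc (-π) π)).prod (volume.restrict (Ioc (-π) π)))
        {z : ℝ × ℝ | |squareDispersion 1 (3 / 10) (p + (kltpPolar (3 / 10) (-μ) z.1 + kltpPolar (3 / 10) (-μ) z.2)) - -μ| < s} ≤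
          ENNReal.ofReal (C * s ^ β))
    (hE : klCertB1gTPm03D0125.EnclosuresB1gTP (-3 / 10)) :
    KLB1gDominatesTP (-3 / 10) ((klCertB1gTPm03D0125.mub : ℚ) : ℝ) ((klCertB1gTPm03D0125.mua : ℚ) : ℝ)
      ((klCertB1gTPm03D0125.gamma : ℚ) : ℝ) :=
  klCertB1gTPm03D0125_dominates_of_HS (fun bx hbx μ hμ =>
    kltp_m03_HS_of_reflected_TSL (klCertB1gTPm03D0125_box_mem' bx hbx μ hμ).1 (klCertB1gTPm03D0125_box_mem' bx hbx μ hμ).2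
      hC hβ0 hβ2 (hTSL bx hbx μ hμ)) hE

/-- **The JOINT record by `γ_J = 88361/2²⁰` MODULO (N3)′ + the joint enclosures (E-J) ONLY.** [cite: RaghuKivelsonScalapino2010, §III Fig. 3] -/
theorem klCertB1gTPm03D0125_dominatesJ_of_TSL {C β : ℝ} (hC : 0 ≤ C) (hβ0 : 0 < β) (hβ2 : β < 2)
    (hTSL : ∀ bx ∈ klCertB1gTPm03D0125.boxes, ∀ μ ∈ Set.Icc (bx.mulo : ℝ) (bx.muhi : ℝ), ∀ (p : Momentum) (s : ℝ), 0 < s →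
      ((volume.restrict (Ioc (-π) π)).prod (volume.restrict (Ioc (-π) π)))
        {z : ℝ × ℝ | |squareDispersion 1 (3 / 10) (p + (kltpPolar (3 / 10) (-μ) z.1 + kltpPolar (3 / 10) (-μ) z.2)) - -μ| < s} ≤
          ENNReal.ofReal (C * s ^ β))
    (hE : JointEnclosuresB1gTP klCertB1gTPm03D0125 klCertB1gTPm03D0125JRows (-3 / 10)) :
    KLB1gDominatesTP (-3 / 10) ((klCertB1gTPm03D0125.mub : ℚ) : ℝ) ((klCertB1gTPm03D0125.mua : ℚ) : ℝ)
      ((klCertB1gTPm03D0125GammaJ : ℚ) : ℝ) :=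
  klCertB1gTPm03D0125_dominatesJ_of_HS (fun bx hbx μ hμ =>
    kltp_m03_HS_of_reflected_TSL (klCertB1gTPm03D0125_box_mem' bx hbx μ hμ).1 (klCertB1gTPm03D0125_box_mem' bx hbx μ hμ).2
      hC hβ0 hβ2 (hTSL bx hbx μ hμ)) hE

end Summit.HubbardSuperconductivity.HubbardSuperconductivity.Theorems

end
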